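import Literature.NumberTheory.EllipticCurves.IwasawaTwistModPDual
import HarnessLib

/-!
# Step 1 of the `μ`-transfer core (`stub_coreX9`, crux 19276): the operators `T` and `ι(T)`

HOME/koly/MU-TRANSFER-PROOF.md §5 STEP 1 / (4.1) / CORE-PLAN §3: the kernel schema
`LevelE.theoremA_contradiction_schema` (tree, p420500) takes two operators `T` on `𝒯_e` and `D` on
`𝒯_e^*` with `(Tx)₀ = 0`, `(Tx)₁ = x₀`, `(Dy)₀ = 0`, `(Dy)₁ = −y₀` and a joint-value module `M`
stable under `(T, D)`. On the GENUINE objects these are `γ₀ − 1` for a topological generator `γ₀`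
of `Γ = Gal(ℚ_∞/ℚ)` fixing `E[p]`: on `𝒯_J = κ.twistModP` it acts as `1 + S`
(tree `twistModP_apply_of_isTopGenerator`), and on the dual deformation `𝒯_J^* = κ.invTwist.twistModP`
(tree `twistDualMap`: the dual carries `χ⁻¹`, (4.1)) as `U := (1+S)^{κ⁻¹(γ₀)}` with `U·(1+S) = 1`
(`unipotentPow_invTwist_mul_one_add_shiftEnd`), so `U y − y = −S(U y)` has coordinates `0 ↦ 0`,
`1 ↦ −y₀`. Joint `(T, D)`-stability of a `Γ_ℚ`-stable `M ⊂ 𝒯_J ⊕ 𝒯_J^*` is then immediate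
(`sub_mem_of_prod_stable`).

PARTITION (D-0054): X9 (A4) — helper toward `stub_coreX9`; closes none.
-/

set_option linter.dupNamespace false

noncomputable section

open Literature.NumberTheory.EllipticCurves Literature.NumberTheory.GaloisRepresentations Field

universe u

namespace Summit.BirchSwinnertonDyer.BirchSwinnertonDyer.Rank1Residual.LevelE

section general

variable {K : Type u} [Field K] {p : ℕ} [Fact p.Prime] (κ : ZpExtension K p)
  {M : Type u} [AddCommGroup M] [TopologicalSpace M] [DiscreteTopology M]
  (ρ : DiscreteGaloisModule K M) (hM : ∀ x : M, p • x = 0) (J : ℕ)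

omit [TopologicalSpace M] [DiscreteTopology M] in
include hM in
/-- **`(1+S)^{κ⁻¹(γ)} · (1+S) = 1` on `𝒯_J`** for a topological generator `γ` of `κ`: the exponents
`κ(γ) ≡ 1` and `κ⁻¹(γ) ≡ −1` add up to `0 (mod p^J)` (tree `prime_pow_dvd_twistExponent_add_invTwist`)
and `(1+S)^{p^J} = 1` (`p·𝒯_J = 0`, `S^J = 0`). [cite: Washington1997, §13.1–§13.2] -/
theorem unipotentPow_invTwist_mul_one_add_shiftEnd {γ : absoluteGaloisGroup K}
    (hγ : κ.IsTopGenerator γ) :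
    unipotentPow M J (κ.invTwist.twistExponent J γ) * (1 + shiftEnd M J) = 1 := by
  rcases Nat.eq_zero_or_pos J with rfl | hJ
  · exact Subsingleton.elim _ _
  · haveI : Fact (1 < p ^ J) := ⟨Nat.one_lt_pow hJ.ne' (Fact.out : p.Prime).one_lt⟩
    have hexp : κ.twistExponent J γ = 1 := by
      rw [ZpExtension.twistExponent, show κ γ = Multiplicative.ofAdd 1 from hγ, toAdd_ofAdd, map_one,
        ZMod.val_one]
    have h1 : (1 + shiftEnd M J) = unipotentPow M J (κ.twistExponent J γ) := by
      rw [hexp, unipotentPow, pow_one]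
    rw [h1, ← unipotentPow_add, add_comm]
    exact unipotentPow_eq_one_of_dvd hM (Nat.lt_pow_self (Fact.out : p.Prime).one_lt).le
      (κ.prime_pow_dvd_twistExponent_add_invTwist J γ)

/-- **`γ − 1` on the dual deformation is `−S·U`**: for `y ∈ 𝒯_J^* = κ⁻¹-twist`,
`γ•y − ρ(γ)y = −S(U(ρ(γ) y))` with `U = (1+S)^{κ⁻¹(γ)}`. [cite: Washington1997, §13.1–§13.2] -/
theorem invTwist_twistModP_apply_sub_of_isTopGenerator {γ : absoluteGaloisGroup K}
    (hγ : κ.IsTopGenerator γ) (y : Fin J → M) :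
    κ.invTwist.twistModP ρ hM J γ y - (fun i => ρ γ (y i)) =
      -(shiftEnd M J (unipotentPow M J (κ.invTwist.twistExponent J γ) (fun i => ρ γ (y i)))) := by
  set z : Fin J → M := fun i => ρ γ (y i) with hz
  set U := unipotentPow M J (κ.invTwist.twistExponent J γ) with hUdef
  have hU : U ((1 + shiftEnd M J) z) = z := by
    rw [hUdef, ← Module.End.mul_apply, unipotentPow_invTwist_mul_one_add_shiftEnd κ hM J hγ,
      Module.End.one_apply]
  rw [LinearMap.add_apply, Module.End.one_apply, map_add] at hU
  have hcomm : U (shiftEnd M J z) = shiftEnd M J (U z) := by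
    rw [← Module.End.mul_apply, hUdef, ← (commute_shiftEnd_unipotentPow _).eq, Module.End.mul_apply]
  rw [ZpExtension.twistModP_apply, ← hz, ← hUdef, ← hcomm]
  calc U z - z = U z - (U z + U (shiftEnd M J z)) := by rw [hU]
    _ = -U (shiftEnd M J z) := by abel

/-- Coordinates of `γ − 1` on the dual deformation: **`(γ•y − ρ(γ)y)₀ = 0`**.
[cite: Washington1997, §13.1–§13.2] -/
theorem invTwist_twistModP_sub_apply_zero {γ : absoluteGaloisGroup K} (hγ : κ.IsTopGenerator γ)
    (hJ : 0 < J) (y : Fin J → M) :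
    (κ.invTwist.twistModP ρ hM J γ y - fun i => ρ γ (y i)) ⟨0, hJ⟩ = 0 := by
  rw [invTwist_twistModP_apply_sub_of_isTopGenerator κ ρ hM J hγ, Pi.neg_apply, shiftEnd_apply,
    dif_pos rfl, neg_zero]

/-- Coordinates of `γ − 1` on the dual deformation: **`(γ•y − ρ(γ)y)₁ = −(ρ(γ)y)₀`** — the
schema's `hD1` (`ι(T) = (1+T)⁻¹ − 1 = −T + T² − …`, (4.1) of the memo). [cite: Washington1997, §13.1–§13.2] -/
theorem invTwist_twistModP_sub_apply_one {γ : absoluteGaloisGroup K} (hγ : κ.IsTopGenerator γ)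
    (hJ : 1 < J) (y : Fin J → M) :
    (κ.invTwist.twistModP ρ hM J γ y - fun i => ρ γ (y i)) ⟨1, hJ⟩ = -ρ γ (y ⟨0, by omega⟩) := by
  rw [invTwist_twistModP_apply_sub_of_isTopGenerator κ ρ hM J hγ, Pi.neg_apply, shiftEnd_apply,
    dif_neg one_ne_zero]
  congr 1
  have h0 : (⟨(((⟨1, hJ⟩ : Fin J) : ℕ)) - 1, by simp; omega⟩ : Fin J) = ⟨0, by omega⟩ := Fin.ext (by simp)
  rw [h0, ZpExtension.unipotentPow_apply_zero]

/-- Coordinates of `γ − 1` on `𝒯_J` itself: **`(γ•x − ρ(γ)x)₀ = 0`** (it is `S(ρ(γ)x)`, tree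
`twistModP_apply_sub_of_isTopGenerator`). [cite: Washington1997, §13.1–§13.2] -/
theorem twistModP_sub_apply_zero {γ : absoluteGaloisGroup K} (hγ : κ.IsTopGenerator γ)
    (hJ : 0 < J) (x : Fin J → M) :
    (κ.twistModP ρ hM J γ x - fun i => ρ γ (x i)) ⟨0, hJ⟩ = 0 := by
  rw [ZpExtension.twistModP_apply_sub_of_isTopGenerator κ ρ hM J hγ, shiftEnd_apply, dif_pos rfl]

/-- Coordinates of `γ − 1` on `𝒯_J` itself: **`(γ•x − ρ(γ)x)₁ = (ρ(γ)x)₀`** — the schema's `hT1`.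
[cite: Washington1997, §13.1–§13.2] -/
theorem twistModP_sub_apply_one {γ : absoluteGaloisGroup K} (hγ : κ.IsTopGenerator γ)
    (hJ : 1 < J) (x : Fin J → M) :
    (κ.twistModP ρ hM J γ x - fun i => ρ γ (x i)) ⟨1, hJ⟩ = ρ γ (x ⟨0, by omega⟩) := by
  rw [ZpExtension.twistModP_apply_sub_of_isTopGenerator κ ρ hM J hγ, shiftEnd_apply,
    dif_neg one_ne_zero]
  have h0 : (⟨(((⟨1, hJ⟩ : Fin J) : ℕ)) - 1, by simp; omega⟩ : Fin J) = ⟨0, by omega⟩ := Fin.ext (by simp)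
  rw [h0]

omit [TopologicalSpace M] [DiscreteTopology M] in
/-- **Joint `(T, ι(T))`-stability is `Γ`-stability** (the schema's `hM`): if an additive subgroup
`N ⊂ 𝒯_J ⊕ 𝒯_J^*` is stable under the diagonal action of `γ`, given by a pair of additive maps
`(f, g)`, then `(f z₁ − z₁, g z₂ − z₂) ∈ N` for `z ∈ N`. [cite: Washington1997, §13.1–§13.2] -/
theorem sub_mem_of_prod_stable {A B : Type u} [AddCommGroup A] [AddCommGroup B] (f : A →+ A) (g : B →+ B)
    (N : AddSubgroup (A × B)) (hN : ∀ z ∈ N, (f z.1, g z.2) ∈ N) {z : A × B} (hz : z ∈ N) :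
    (f z.1 - z.1, g z.2 - z.2) ∈ N := by
  have h : (f z.1 - z.1, g z.2 - z.2) = (f z.1, g z.2) - z := rfl
  rw [h]
  exact N.sub_mem (hN z hz) hz

end general

end Summit.BirchSwinnertonDyer.BirchSwinnertonDyer.Rank1Residual.LevelE

end
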